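import Summits.BirchSwinnertonDyer.BirchSwinnertonDyer.Theorems.KolyvaginDepthDoorDepthTableKuriharaRankPin
import HarnessLib

/-!
# Route `KolyvaginDepthDoor`, crux `KolyvaginDepthSupplyKN` (stmt-BirchSwinnertonDyer-22820) —
# DEPTH TABLE v26 «THE RECORD PINS THE RANK», row shapes for a literal integral model

Helper file of the lead prover of line `levelone` (kdd-p1 g30; `--supports stmt-BirchSwinnertonDyer-22820
--as helper`); it closes nothing and BSD is NOT proved by it.

Companion of `KolyvaginDepthDoorDepthTableKuriharaRankPin` (§1–§4 there: `2 ≤ rank` from the localisation matrix,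
`rank ≤ ν` from `#Sel_p ≤ p^ν`, the self-certifying one-way row at any good prime, the two-way form with the rank
inside). Here: the two shapes the per-record rows instantiate for the rational curve of an integral globally
minimal equation `E₀` — `rank_eq_two_and_sha_eq_bot_of_kuriharaClaim_of_supersingular_int` (good supersingular
`p ≥ 5`: Kim's (iii) automatic, (iv) from the Kodaira–Néron clause) and
`rank_eq_two_and_sha_eq_bot_of_kuriharaClaim_of_hasGoodReduction_int` (any good `p ≥ 5`, (iii) as a binder, (iv)
from the split multiplicative places). Each consumes the record's CLAIM and the row's existing
`localizationInvertible_<p>_<n>` theorem (`h01`, `h10`, `h1t`) and returns `rank_ℤ E(ℚ) = 2 ∧ Ш(E/ℚ)[p] = 0` — no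
`2 ≤ rank` input, no 2-descent module.

HONEST FRAMING. Per curve; CONDITIONAL on `hKimG`, `hnf`, `hMaz` by name and on the record's claim; instrument rows
(a supersingular `p` is not admissible for the crux); nothing class-wide; BSD is NOT proved by any of this.

References: [Kim2022StructureSelmer] Thm. 1.11 (PDF p. 8), §3.1.1; [SilvermanAEC2009] VII.3.1, VIII.6.7, X.4.2;
[SilvermanATAEC1994] Cor. IV.9.2 (d).
-/

set_option linter.dupNamespace false

noncomputable section

open scoped Classical NumberField

namespace Summit.BirchSwinnertonDyer.BirchSwinnertonDyer.Theorems.KolyvaginDepthDoor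

open Literature.NumberTheory.EllipticCurves Literature.NumberTheory.EllipticCurves.ModularForms
  WeierstrassCurve NumberField IsDedekindDomain
open Summit.BirchSwinnertonDyer.BirchSwinnertonDyer.Theorems

/-! ## Row shapes for a literal integral model (what the per-record rows instantiate) -/

/-- **THE SELF-CERTIFYING SUPERSINGULAR ROW: `rank_ℤ E(ℚ) = 2 ∧ Ш(E/ℚ)[p] = 0` ⟸ ONE unit Kurihara number at a
cyclic depth-two level `ℓ₁ℓ₂` + the three local witnesses**, for the rational curve of an integral GLOBALLY
MINIMAL equation `E₀`, at a good SUPERSINGULAR `p ≥ 5` (`p ∣ a_p`) with `ρ̄` onto and the Kodaira–Néron clause —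
(iii) automatic (v25 §2), (iv) by Kodaira–Néron, then §3. Instrument row (a supersingular `p` is not admissible
for the crux). CONDITIONAL on `hKimG`, modularity, Mazur and the claim; per curve; BSD is not proved by it.
[cite: Kim2022StructureSelmer, Thm. 1.11 (PDF p. 8), §3.1.1] [cite: SilvermanAEC2009, VII.3 Prop. 3.1, Thm. X.4.2] -/
theorem rank_eq_two_and_sha_eq_bot_of_kuriharaClaim_of_supersingular_int
    (hKimG : Literature.NumberTheory.EllipticCurves.Kim2022_card_selmerGroup_le_pow_of_kuriharaNumber_ne_zero_of_hasGoodReduction)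
    (hnf : exists_isNewformOf) (hMaz : mazur_not_dvd_maninConstant_of_odd)
    (W₀ : WeierstrassCurve ℤ) [(W₀.map (Int.castRingHom ℚ)).IsElliptic]
    [(W₀.map (Int.castRingHom ℚ)).IsGloballyMinimal] (p : ℕ) [hp : Fact p.Prime] (h5 : 5 ≤ p)
    (hgood : (W₀.map (Int.castRingHom ℚ)).HasGoodReductionAtPrime p)
    (hss : (p : ℤ) ∣ (W₀.map (Int.castRingHom ℚ)).frobeniusTrace p)
    (hsur : (W₀.map (Int.castRingHom ℚ)).HasSurjectiveModNGaloisRep p)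
    (hKN : ∀ v : HeightOneSpectrum (𝓞 ℚ), (W₀.map (Int.castRingHom ℚ)).HasMultiplicativeReductionAt v →
      ¬ p ∣ (W₀.map (Int.castRingHom ℚ)).ordMinimalDiscriminant v)
    [iNZ : NeZero ((W₀.map (Int.castRingHom ℚ)).conductorNorm ℤ)]
    (ℓ₁ ℓ₂ n : ℕ) [Fact ℓ₁.Prime] [Fact ℓ₂.Prime] (hne : ℓ₁ ≠ ℓ₂) (hnl : ℓ₁ * ℓ₂ = n) [NeZero n]
    (hn : IsCyclicKolyvaginLevel (W₀.map (Int.castRingHom ℚ)) p n)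
    (P₁ P₂ : (W₀.map (Int.castRingHom ℚ)).toAffine.Point)
    (h01 : (∀ Q : ((W₀.map (Int.castRingHom ℚ)).baseChange ℚ_[ℓ₁]).toAffine.Point,
        p • Q ≠ WeierstrassCurve.Affine.Point.map (W' := (W₀.map (Int.castRingHom ℚ)).toAffine) (S := ℚ)
          (Algebra.ofId ℚ ℚ_[ℓ₁]) P₂) ∨
      (∀ Q : ((W₀.map (Int.castRingHom ℚ)).baseChange ℚ_[ℓ₂]).toAffine.Point,
        p • Q ≠ WeierstrassCurve.Affine.Point.map (W' := (W₀.map (Int.castRingHom ℚ)).toAffine) (S := ℚ)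
          (Algebra.ofId ℚ ℚ_[ℓ₂]) P₂))
    (h10 : (∀ Q : ((W₀.map (Int.castRingHom ℚ)).baseChange ℚ_[ℓ₁]).toAffine.Point,
        p • Q ≠ WeierstrassCurve.Affine.Point.map (W' := (W₀.map (Int.castRingHom ℚ)).toAffine) (S := ℚ)
          (Algebra.ofId ℚ ℚ_[ℓ₁]) P₁) ∨
      (∀ Q : ((W₀.map (Int.castRingHom ℚ)).baseChange ℚ_[ℓ₂]).toAffine.Point,
        p • Q ≠ WeierstrassCurve.Affine.Point.map (W' := (W₀.map (Int.castRingHom ℚ)).toAffine) (S := ℚ)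
          (Algebra.ofId ℚ ℚ_[ℓ₂]) P₁))
    (h1t : ∀ t, 1 ≤ t → t < p →
      (∀ Q : ((W₀.map (Int.castRingHom ℚ)).baseChange ℚ_[ℓ₁]).toAffine.Point,
        p • Q ≠ 1 • WeierstrassCurve.Affine.Point.map (W' := (W₀.map (Int.castRingHom ℚ)).toAffine) (S := ℚ)
            (Algebra.ofId ℚ ℚ_[ℓ₁]) P₁ +
          t • WeierstrassCurve.Affine.Point.map (W' := (W₀.map (Int.castRingHom ℚ)).toAffine) (S := ℚ)
            (Algebra.ofId ℚ ℚ_[ℓ₁]) P₂) ∨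
      (∀ Q : ((W₀.map (Int.castRingHom ℚ)).baseChange ℚ_[ℓ₂]).toAffine.Point,
        p • Q ≠ 1 • WeierstrassCurve.Affine.Point.map (W' := (W₀.map (Int.castRingHom ℚ)).toAffine) (S := ℚ)
            (Algebra.ofId ℚ ℚ_[ℓ₂]) P₁ +
          t • WeierstrassCurve.Affine.Point.map (W' := (W₀.map (Int.castRingHom ℚ)).toAffine) (S := ℚ)
            (Algebra.ofId ℚ ℚ_[ℓ₂]) P₂))
    (hδ : ∀ (D : ModularParametrizationData (W₀.map (Int.castRingHom ℚ))
        ((W₀.map (Int.castRingHom ℚ)).conductorNorm ℤ)), ¬ (p : ℤ) ∣ D.maninConstant →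
      (∃ u : ℚ, ‖(u : ℚ_[p])‖ = 1 ∧ (W₀.map (Int.castRingHom ℚ)).realPeriodRat = u * plusPeriod D.f) →
      ∃ ψ : (ℓ : ℕ) → (ZMod ℓ)ˣ →* Multiplicative (ZMod p),
        (∀ ℓ ∈ n.primeFactors, Function.Surjective (ψ ℓ)) ∧ kuriharaNumber D.f p n ψ ≠ 0) :
    (W₀.map (Int.castRingHom ℚ)).mordellWeilRank = 2 ∧
      ((W₀.map (Int.castRingHom ℚ)).sha ⊓
        AddSubgroup.torsionBy (W₀.map (Int.castRingHom ℚ)).galH1 (p : ℤ) : AddSubgroup _) = ⊥ :=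
  rank_eq_two_and_sha_eq_bot_of_kuriharaClaim_of_localWitness hKimG hnf hMaz _ p h5 hgood hsur
    (localTorsionTrivial_of_supersingular _ p (by omega) hgood hss)
    (not_dvd_tamagawaProduct_of_kodairaNeron _ p h5 hKN) ℓ₁ ℓ₂ n hne hnl hn P₁ P₂ h01 h10 h1t hδ

/-- **The general good-prime self-certifying row shape** (ordinary or supersingular, anomalous allowed): `rank = 2 ∧
Ш(E/ℚ)[p] = 0` ⟸ ONE unit Kurihara number at a cyclic depth-two level + the three local witnesses, for the rational
curve of an integral globally minimal `E₀`, at a good `p ≥ 5` with `ρ̄` onto, the binder (iii) `E(ℚ_p)[p] = 0`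
(point count or division-polynomial certificate) and (iv) from the SPLIT multiplicative places only. CONDITIONAL
on `hKimG`, modularity, Mazur and the claim; per curve; BSD is not proved by it.
[cite: Kim2022StructureSelmer, Thm. 1.11 (PDF p. 8)] [cite: SilvermanATAEC1994, Cor. IV.9.2 (d)] -/
theorem rank_eq_two_and_sha_eq_bot_of_kuriharaClaim_of_hasGoodReduction_int
    (hKimG : Literature.NumberTheory.EllipticCurves.Kim2022_card_selmerGroup_le_pow_of_kuriharaNumber_ne_zero_of_hasGoodReduction)
    (hnf : exists_isNewformOf) (hMaz : mazur_not_dvd_maninConstant_of_odd)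
    (W₀ : WeierstrassCurve ℤ) [(W₀.map (Int.castRingHom ℚ)).IsElliptic]
    [(W₀.map (Int.castRingHom ℚ)).IsGloballyMinimal] (p : ℕ) [hp : Fact p.Prime] (h5 : 5 ≤ p)
    (hgood : (W₀.map (Int.castRingHom ℚ)).HasGoodReductionAtPrime p)
    (hsur : (W₀.map (Int.castRingHom ℚ)).HasSurjectiveModNGaloisRep p)
    (ht0 : ∀ P : ((W₀.map (Int.castRingHom ℚ)).baseChange ℚ_[p]).toAffine.Point, (p : ℤ) • P = 0 → P = 0)
    (hsKN : ∀ v : HeightOneSpectrum (𝓞 ℚ), (W₀.map (Int.castRingHom ℚ)).HasSplitMultiplicativeReductionAt v →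
      ¬ p ∣ (W₀.map (Int.castRingHom ℚ)).ordMinimalDiscriminant v)
    [iNZ : NeZero ((W₀.map (Int.castRingHom ℚ)).conductorNorm ℤ)]
    (ℓ₁ ℓ₂ n : ℕ) [Fact ℓ₁.Prime] [Fact ℓ₂.Prime] (hne : ℓ₁ ≠ ℓ₂) (hnl : ℓ₁ * ℓ₂ = n) [NeZero n]
    (hn : IsCyclicKolyvaginLevel (W₀.map (Int.castRingHom ℚ)) p n)
    (P₁ P₂ : (W₀.map (Int.castRingHom ℚ)).toAffine.Point)
    (h01 : (∀ Q : ((W₀.map (Int.castRingHom ℚ)).baseChange ℚ_[ℓ₁]).toAffine.Point,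
        p • Q ≠ WeierstrassCurve.Affine.Point.map (W' := (W₀.map (Int.castRingHom ℚ)).toAffine) (S := ℚ)
          (Algebra.ofId ℚ ℚ_[ℓ₁]) P₂) ∨
      (∀ Q : ((W₀.map (Int.castRingHom ℚ)).baseChange ℚ_[ℓ₂]).toAffine.Point,
        p • Q ≠ WeierstrassCurve.Affine.Point.map (W' := (W₀.map (Int.castRingHom ℚ)).toAffine) (S := ℚ)
          (Algebra.ofId ℚ ℚ_[ℓ₂]) P₂))
    (h10 : (∀ Q : ((W₀.map (Int.castRingHom ℚ)).baseChange ℚ_[ℓ₁]).toAffine.Point,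
        p • Q ≠ WeierstrassCurve.Affine.Point.map (W' := (W₀.map (Int.castRingHom ℚ)).toAffine) (S := ℚ)
          (Algebra.ofId ℚ ℚ_[ℓ₁]) P₁) ∨
      (∀ Q : ((W₀.map (Int.castRingHom ℚ)).baseChange ℚ_[ℓ₂]).toAffine.Point,
        p • Q ≠ WeierstrassCurve.Affine.Point.map (W' := (W₀.map (Int.castRingHom ℚ)).toAffine) (S := ℚ)
          (Algebra.ofId ℚ ℚ_[ℓ₂]) P₁))
    (h1t : ∀ t, 1 ≤ t → t < p →
      (∀ Q : ((W₀.map (Int.castRingHom ℚ)).baseChange ℚ_[ℓ₁]).toAffine.Point,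
        p • Q ≠ 1 • WeierstrassCurve.Affine.Point.map (W' := (W₀.map (Int.castRingHom ℚ)).toAffine) (S := ℚ)
            (Algebra.ofId ℚ ℚ_[ℓ₁]) P₁ +
          t • WeierstrassCurve.Affine.Point.map (W' := (W₀.map (Int.castRingHom ℚ)).toAffine) (S := ℚ)
            (Algebra.ofId ℚ ℚ_[ℓ₁]) P₂) ∨
      (∀ Q : ((W₀.map (Int.castRingHom ℚ)).baseChange ℚ_[ℓ₂]).toAffine.Point,
        p • Q ≠ 1 • WeierstrassCurve.Affine.Point.map (W' := (W₀.map (Int.castRingHom ℚ)).toAffine) (S := ℚ)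
            (Algebra.ofId ℚ ℚ_[ℓ₂]) P₁ +
          t • WeierstrassCurve.Affine.Point.map (W' := (W₀.map (Int.castRingHom ℚ)).toAffine) (S := ℚ)
            (Algebra.ofId ℚ ℚ_[ℓ₂]) P₂))
    (hδ : ∀ (D : ModularParametrizationData (W₀.map (Int.castRingHom ℚ))
        ((W₀.map (Int.castRingHom ℚ)).conductorNorm ℤ)), ¬ (p : ℤ) ∣ D.maninConstant →
      (∃ u : ℚ, ‖(u : ℚ_[p])‖ = 1 ∧ (W₀.map (Int.castRingHom ℚ)).realPeriodRat = u * plusPeriod D.f) →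
      ∃ ψ : (ℓ : ℕ) → (ZMod ℓ)ˣ →* Multiplicative (ZMod p),
        (∀ ℓ ∈ n.primeFactors, Function.Surjective (ψ ℓ)) ∧ kuriharaNumber D.f p n ψ ≠ 0) :
    (W₀.map (Int.castRingHom ℚ)).mordellWeilRank = 2 ∧
      ((W₀.map (Int.castRingHom ℚ)).sha ⊓
        AddSubgroup.torsionBy (W₀.map (Int.castRingHom ℚ)).galH1 (p : ℤ) : AddSubgroup _) = ⊥ :=
  rank_eq_two_and_sha_eq_bot_of_kuriharaClaim_of_localWitness hKimG hnf hMaz _ p h5 hgood hsur ht0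
    (not_dvd_tamagawaProduct_of_splitKodairaNeron _ p h5 hsKN) ℓ₁ ℓ₂ n hne hnl hn P₁ P₂ h01 h10 h1t hδ


/-- **The good-prime self-certifying row shape with the binder (iii) and the FULL Kodaira–Néron clause** (the
ANOMALOUS-certified rows: `E(ℚ_p)[p] = 0` by a division-polynomial certificate, (iv) from `p ∤ ord_v(Δ_min)` at ALL
multiplicative places): `rank = 2 ∧ Ш(E/ℚ)[p] = 0` ⟸ ONE unit Kurihara number at a cyclic depth-two level + the
three local witnesses. CONDITIONAL on `hKimG`, modularity, Mazur and the claim; per curve; BSD is not proved by it.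
[cite: Kim2022StructureSelmer, Thm. 1.11 (PDF p. 8)] [cite: SilvermanATAEC1994, Cor. IV.9.2 (d)] -/
theorem rank_eq_two_and_sha_eq_bot_of_kuriharaClaim_of_kodairaNeron_int
    (hKimG : Literature.NumberTheory.EllipticCurves.Kim2022_card_selmerGroup_le_pow_of_kuriharaNumber_ne_zero_of_hasGoodReduction)
    (hnf : exists_isNewformOf) (hMaz : mazur_not_dvd_maninConstant_of_odd)
    (W₀ : WeierstrassCurve ℤ) [(W₀.map (Int.castRingHom ℚ)).IsElliptic]
    [(W₀.map (Int.castRingHom ℚ)).IsGloballyMinimal] (p : ℕ) [hp : Fact p.Prime] (h5 : 5 ≤ p)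
    (hgood : (W₀.map (Int.castRingHom ℚ)).HasGoodReductionAtPrime p)
    (hsur : (W₀.map (Int.castRingHom ℚ)).HasSurjectiveModNGaloisRep p)
    (ht0 : ∀ P : ((W₀.map (Int.castRingHom ℚ)).baseChange ℚ_[p]).toAffine.Point, (p : ℤ) • P = 0 → P = 0)
    (hKN : ∀ v : HeightOneSpectrum (𝓞 ℚ), (W₀.map (Int.castRingHom ℚ)).HasMultiplicativeReductionAt v →
      ¬ p ∣ (W₀.map (Int.castRingHom ℚ)).ordMinimalDiscriminant v)
    [iNZ : NeZero ((W₀.map (Int.castRingHom ℚ)).conductorNorm ℤ)]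
    (ℓ₁ ℓ₂ n : ℕ) [Fact ℓ₁.Prime] [Fact ℓ₂.Prime] (hne : ℓ₁ ≠ ℓ₂) (hnl : ℓ₁ * ℓ₂ = n) [NeZero n]
    (hn : IsCyclicKolyvaginLevel (W₀.map (Int.castRingHom ℚ)) p n)
    (P₁ P₂ : (W₀.map (Int.castRingHom ℚ)).toAffine.Point)
    (h01 : (∀ Q : ((W₀.map (Int.castRingHom ℚ)).baseChange ℚ_[ℓ₁]).toAffine.Point,
        p • Q ≠ WeierstrassCurve.Affine.Point.map (W' := (W₀.map (Int.castRingHom ℚ)).toAffine) (S := ℚ)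
          (Algebra.ofId ℚ ℚ_[ℓ₁]) P₂) ∨
      (∀ Q : ((W₀.map (Int.castRingHom ℚ)).baseChange ℚ_[ℓ₂]).toAffine.Point,
        p • Q ≠ WeierstrassCurve.Affine.Point.map (W' := (W₀.map (Int.castRingHom ℚ)).toAffine) (S := ℚ)
          (Algebra.ofId ℚ ℚ_[ℓ₂]) P₂))
    (h10 : (∀ Q : ((W₀.map (Int.castRingHom ℚ)).baseChange ℚ_[ℓ₁]).toAffine.Point,
        p • Q ≠ WeierstrassCurve.Affine.Point.map (W' := (W₀.map (Int.castRingHom ℚ)).toAffine) (S := ℚ)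
          (Algebra.ofId ℚ ℚ_[ℓ₁]) P₁) ∨
      (∀ Q : ((W₀.map (Int.castRingHom ℚ)).baseChange ℚ_[ℓ₂]).toAffine.Point,
        p • Q ≠ WeierstrassCurve.Affine.Point.map (W' := (W₀.map (Int.castRingHom ℚ)).toAffine) (S := ℚ)
          (Algebra.ofId ℚ ℚ_[ℓ₂]) P₁))
    (h1t : ∀ t, 1 ≤ t → t < p →
      (∀ Q : ((W₀.map (Int.castRingHom ℚ)).baseChange ℚ_[ℓ₁]).toAffine.Point,
        p • Q ≠ 1 • WeierstrassCurve.Affine.Point.map (W' := (W₀.map (Int.castRingHom ℚ)).toAffine) (S := ℚ)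
            (Algebra.ofId ℚ ℚ_[ℓ₁]) P₁ +
          t • WeierstrassCurve.Affine.Point.map (W' := (W₀.map (Int.castRingHom ℚ)).toAffine) (S := ℚ)
            (Algebra.ofId ℚ ℚ_[ℓ₁]) P₂) ∨
      (∀ Q : ((W₀.map (Int.castRingHom ℚ)).baseChange ℚ_[ℓ₂]).toAffine.Point,
        p • Q ≠ 1 • WeierstrassCurve.Affine.Point.map (W' := (W₀.map (Int.castRingHom ℚ)).toAffine) (S := ℚ)
            (Algebra.ofId ℚ ℚ_[ℓ₂]) P₁ +
          t • WeierstrassCurve.Affine.Point.map (W' := (W₀.map (Int.castRingHom ℚ)).toAffine) (S := ℚ)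
            (Algebra.ofId ℚ ℚ_[ℓ₂]) P₂))
    (hδ : ∀ (D : ModularParametrizationData (W₀.map (Int.castRingHom ℚ))
        ((W₀.map (Int.castRingHom ℚ)).conductorNorm ℤ)), ¬ (p : ℤ) ∣ D.maninConstant →
      (∃ u : ℚ, ‖(u : ℚ_[p])‖ = 1 ∧ (W₀.map (Int.castRingHom ℚ)).realPeriodRat = u * plusPeriod D.f) →
      ∃ ψ : (ℓ : ℕ) → (ZMod ℓ)ˣ →* Multiplicative (ZMod p),
        (∀ ℓ ∈ n.primeFactors, Function.Surjective (ψ ℓ)) ∧ kuriharaNumber D.f p n ψ ≠ 0) :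
    (W₀.map (Int.castRingHom ℚ)).mordellWeilRank = 2 ∧
      ((W₀.map (Int.castRingHom ℚ)).sha ⊓
        AddSubgroup.torsionBy (W₀.map (Int.castRingHom ℚ)).galH1 (p : ℤ) : AddSubgroup _) = ⊥ :=
  rank_eq_two_and_sha_eq_bot_of_kuriharaClaim_of_localWitness hKimG hnf hMaz _ p h5 hgood hsur ht0
    (not_dvd_tamagawaProduct_of_kodairaNeron _ p h5 hKN) ℓ₁ ℓ₂ n hne hnl hn P₁ P₂ h01 h10 h1t hδ

end Summit.BirchSwinnertonDyer.BirchSwinnertonDyer.Theorems.KolyvaginDepthDoor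

end
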